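import Summits.NavierStokesRegularity.NavierStokesRegularity.Theorems.EfficiencyFloorMaximiserSetRigidityProfileVorticity
import Summits.NavierStokesRegularity.NavierStokesRegularity.Theorems.EfficiencyFloorMaximiserSetRigidityPartBReduction
import Summits.NavierStokesRegularity.NavierStokesRegularity.Theorems.EfficiencyFloorMaximiserSetRigidityProfileEnstrophyBalanceTools
import Summits.NavierStokesRegularity.NavierStokesRegularity.Theorems.SoloSalvageMagsanop2026Enstrophy
import HarnessLib

/-!
# Route `EfficiencyFloor`, crux `MaximiserSetRigidity` (stmt-NavierStokesRegularity-25512), part (b):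
# the ENSTROPHY BALANCE (EB) of relative-equilibrium profiles — PROVED

Helper file (`--supports stmt-NavierStokesRegularity-25512`; ladder `MaximiserSetRigidity → RigidExit →
NearMaximiserBoundedAmplification → LerayFloorGap`, a rung of the crux `ProductionEfficiencyDecay` stmt-22866).
Sequel to `…MaximiserSetRigidityEnstrophyBalance` (p820129, the algebra), `…PartBReduction` (p820369: (b) for a
normalised maximiser ⟸ (EB) ∧ (L⁺)) and `…ProfileVorticity` (p820514: the pointwise vorticity form of the profile
equation). Here the analytic hypothesis (EB) of p820369 is DISCHARGED:

* `stretch_sub_visc_eq` / `enstrophyBalance` — for every smooth divergence-free `m` with `D⁰m, D¹m, D²m ∈ L²`,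
  every smooth `π`, skew-adjoint `W`, `a ∈ ℝ³`, `c′ ∈ ℝ` with
  `νΔm − (m·∇)m − ∇π = (a·∇)m + ((Wx)·∇)m − Wm + c′(m + (x·∇)m)` pointwise:
  `S(m) − ν·Pal(m) = (c′/2)·Z(m)`, `S = ∫⟪ω, ∇m ω⟫`, `Pal = ∫|∇ω|²_F`, `Z = ∫|ω|²`, `ω = curl m`
  (`enstrophyBalance` is the hypothesis `hEB` of p820369 VERBATIM).

PROOF. The vorticity form `νΔω − ((m·∇)ω − (ω·∇)m) = (a·∇)ω + ((Wx)·∇)ω − Wω + c′(2ω + (x·∇)ω)` (p820514) is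
tested against `χ_R ω` with the tree's radial cut-offs `χ_R = cutoff R` and integrated; the tree's boundary-free
cut-off identities (`WholeSpaceIBPEnstrophy`: `∫χ⟪Δω,ω⟫ = −∫χ|∇ω|²_F + ½∫|ω|²Δχ`, `2∫χ⟪(V·∇)ω,ω⟫ = −∫(Dχ V)|ω|²`
for `div V = 0` — used with `V = m`, `V ≡ a`, `V = W·` (`tr W = 0`) —, `2∫χ⟪(x·∇)ω,ω⟫ = −∫(Dχ x)|ω|² − 3∫χ|ω|²`,
and `⟪Wω,ω⟫ = 0`) turn it into a linear identity between cut-off integrals, and `R = n + 1 → ∞`: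
`∫χ|∇ω|² → Pal`, `∫χ⟪ω,∇m ω⟫ → S`, `∫χ|ω|² → Z` (dominated convergence, `tendsto_integral_cutoff_mul`),
`∫|ω|²Δχ → 0` (`|Δχ_R| ≤ C/R²`), `∫(Dχ m)|ω|² → 0` (`|m||ω|² ∈ L¹` from `m ∈ L²`, `ω ∈ L⁴`), `∫(Dχ a)|ω|² → 0`,
`∫(Dχ (Wx))|ω|² → 0` (`|Dχ_R(x)(Wx)| ≤ 2c‖W‖` on the shell — the flux need not be integrable),
`∫(Dχ x)|ω|² → 0` (SimilarityEnstrophyIBP). Integrability of `|ω|², |ω|⁴, |∇ω|²_F, |Dm|²` is the tree's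
`Magsanop2026Enstrophy.slice_integrable` (Ladyzhenskaya / Sobolev `H¹ ⊂ L⁶`). No decay RATE of `m` is used.

CONSEQUENCES (pure logic on p820369):
* `rate_pos_of_profile` — a normalised maximiser can solve the profile equation only with the COLLAPSING rate
  `c′ = (27c⁴/(128ν³))Z² > 0`: steady / travelling / rigidly rotating / expanding maximiser profiles are excluded
  UNCONDITIONALLY (this is the `c ≤ 0` half of the item's (b), previously conditional on (EB));
* `partB_of_collapseLiouville` — the item's (b)-clause for every normalised maximiser now follows from the single
  remaining input (L⁺): the Liouville theorem for collapsing (`c′ > 0`) profiles with drift `a` and rotation `W` in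
  the class `D⁰m, D¹m, D²m ∈ L²` (Nečas–Růžička–Šverák 1996 / Tsai 1998 / Pineau–Vicol 2026 type; in print, to be
  matched with the tree's named facts).

HONEST FRAMING: an identity about HYPOTHETICAL profiles and two implications; part (a) of stmt-25512 (finitely
many maximiser orbits), (L⁺), `RigidExit`, `LerayFloorGap`, `ProductionEfficiencyDecay` and Navier–Stokes
regularity stay OPEN; no summit statement is proved. References: Majda–Bertozzi 2002 §1.2 (transport
identities); Evans 2010 App. C.2 (Green); Nečas–Růžička–Šverák 1996, Tsai 1998 (self-similar profiles). [folklore]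
-/

noncomputable section

-- the problem directory repeats the summit name (`NavierStokesRegularity/NavierStokesRegularity`)
set_option linter.dupNamespace false

namespace Summit.NavierStokesRegularity.NavierStokesRegularity.Theorems

namespace MaximiserSetRigidity

namespace ProfileEnstrophyBalance

open MeasureTheory Set Filter Topology Module InnerProductSpace
open scoped RealInnerProductSpace Laplacian ContDiff
open Literature.Analysis Literature.Analysis.FluidPDE
open Summit.NavierStokesRegularity.NavierStokesRegularity.Theorems.SimilarityEnstrophy
  (tendsto_integral_fderiv_cutoff_self_mul tendsto_integral_fderiv_cutoff_apply_mul)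
open Summit.NavierStokesRegularity.NavierStokesRegularity.Theorems.Magsanop2026Enstrophy
  (slice_integrable abs_inner_stretch_le)

/-! ### The enstrophy balance -/

/-- **(EB) The enstrophy balance of a relative-equilibrium profile.** For a smooth divergence-free `m` with
`D⁰m, D¹m, D²m ∈ L²`, `π ∈ C²`, `W` skew-adjoint and
`νΔm − (m·∇)m − ∇π = (a·∇)m + ((Wx)·∇)m − Wm + c′(m + (x·∇)m)` pointwise:
`∫⟪ω, ∇m ω⟫ − ν ∫|∇ω|²_F = (c′/2) ∫|ω|²` (`ω = curl m`). This is the enstrophy identity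
`½ dZ/dt = S − ν·Pal` along the symmetry orbit `t ↦ g(t)·m` read off on the profile (`Z` scales like `λ`,
`S, Pal` like `λ³`, `c′ = λ′/λ³`); proved directly by cut-off integration by parts. [folklore] -/
theorem stretch_sub_visc_eq {ν c' : ℝ} {a : (EuclideanSpace ℝ (Fin 3))} {W : (EuclideanSpace ℝ (Fin 3)) →L[ℝ] (EuclideanSpace ℝ (Fin 3))} {m : (EuclideanSpace ℝ (Fin 3)) → (EuclideanSpace ℝ (Fin 3))} {π : (EuclideanSpace ℝ (Fin 3)) → ℝ}
    (hm : ContDiff ℝ ∞ m) (hdiv : VectorCalculus.IsDivFree m)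
    (h0 : ∫⁻ x, ‖iteratedFDeriv ℝ 0 m x‖ₑ ^ 2 < ⊤) (h1 : ∫⁻ x, ‖iteratedFDeriv ℝ 1 m x‖ₑ ^ 2 < ⊤)
    (h2 : ∫⁻ x, ‖iteratedFDeriv ℝ 2 m x‖ₑ ^ 2 < ⊤) (hπ : ContDiff ℝ 2 π)
    (hW : ∀ x y : (EuclideanSpace ℝ (Fin 3)), ⟪W x, y⟫ = -⟪x, W y⟫)
    (heq : ∀ x : (EuclideanSpace ℝ (Fin 3)), ν • Δ m x - convect m m x - gradient π x =
      fderiv ℝ m x a + (fderiv ℝ m x (W x) - W (m x)) + c' • (m x + fderiv ℝ m x x)) :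
    (∫ x, ⟪curl m x, fderiv ℝ m x (curl m x)⟫) - ν * (∫ x, frobeniusNormSq (fderiv ℝ (curl m) x)) =
      c' / 2 * ∫ x, ‖curl m x‖ ^ 2 := by
  -- regularity
  have hm3 : ContDiff ℝ 3 m := contDiff_infty.1 hm 3
  have hw : ContDiff ℝ ∞ (curl m) := contDiff_curl (n := (⊤ : ℕ∞)) (by exact_mod_cast hm)
  have hwc : Continuous (curl m) := hw.continuous
  have hDwc : Continuous (fderiv ℝ (curl m)) := hw.continuous_fderiv (by simp)
  have hDmc : Continuous (fderiv ℝ m) := hm.continuous_fderiv (by simp)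
  have hmc : Continuous m := hm.continuous
  have hΔwc : Continuous (Δ (curl m)) := continuous_laplacian (contDiff_infty.1 hw 2)
  -- integrability
  obtain ⟨I2, -, IF, -, I4, IDv, -⟩ := slice_integrable hm3 h1 h2
  have Im2 : Integrable (fun x => ‖m x‖ ^ 2) := by
    have h0' : ∫⁻ x, ‖m x‖ₑ ^ 2 < ⊤ := by
      refine lt_of_le_of_lt (le_of_eq (lintegral_congr fun x => ?_)) h0
      rw [← ofReal_norm, ← norm_iteratedFDeriv_zero (𝕜 := ℝ) (f := m), ofReal_norm]
    exact integrable_sq_norm_of_lintegral_lt_top hmc h0'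
  have IS : Integrable (fun x => ⟪curl m x, fderiv ℝ m x (curl m x)⟫) := by
    refine ((I4.add IDv).div_const 2).mono' (hwc.inner (hDmc.clm_apply hwc)).aestronglyMeasurable
      (ae_of_all _ fun x => ?_)
    rw [Real.norm_eq_abs]
    simp only [Pi.add_apply]
    calc |⟪curl m x, fderiv ℝ m x (curl m x)⟫| ≤ ‖curl m x‖ ^ 2 * ‖fderiv ℝ m x‖ :=
          abs_inner_stretch_le m x
      _ ≤ (‖curl m x‖ ^ 4 + ‖fderiv ℝ m x‖ ^ 2) / 2 := by
          nlinarith [sq_nonneg (‖curl m x‖ ^ 2 - ‖fderiv ℝ m x‖)]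
  have IM : Integrable (fun x => ‖m x‖ * ‖curl m x‖ ^ 2) := by
    refine ((Im2.add I4).div_const 2).mono' (hmc.norm.mul (hwc.norm.pow 2)).aestronglyMeasurable
      (ae_of_all _ fun x => ?_)
    rw [Real.norm_of_nonneg (by positivity)]
    simp only [Pi.add_apply]
    nlinarith [sq_nonneg (‖m x‖ - ‖curl m x‖ ^ 2)]
  -- the vorticity equation, tested pointwise against `ω = curl m`
  have hpt : ∀ x, ν * ⟪Δ (curl m) x, curl m x⟫ - ⟪convect m (curl m) x, curl m x⟫ +
      ⟪curl m x, fderiv ℝ m x (curl m x)⟫ =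
      ⟪convect (fun _ => a) (curl m) x, curl m x⟫ + ⟪convect (⇑W) (curl m) x, curl m x⟫ +
        c' * (2 * ‖curl m x‖ ^ 2 + ⟪fderiv ℝ (curl m) x x, curl m x⟫) := by
    intro x
    have h := congrArg (fun v => ⟪v, curl m x⟫)
      (ProfileVorticity.vorticity_form hm3 hdiv hπ hW heq x)
    simp only [convect, inner_sub_left, inner_add_left, real_inner_smul_left, two_smul,
      real_inner_self_eq_norm_sq, inner_skew_self hW] at h ⊢
    rw [real_inner_comm (fderiv ℝ m x (curl m x)) (curl m x)]
    linarith
  -- the cut-off identities, one for each `n`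
  have hn : ∀ n : ℕ,
      ν * (∫ x, cutoff ((n : ℝ) + 1) x * ⟪Δ (curl m) x, curl m x⟫) -
        (∫ x, cutoff ((n : ℝ) + 1) x * ⟪convect m (curl m) x, curl m x⟫) +
        (∫ x, cutoff ((n : ℝ) + 1) x * ⟪curl m x, fderiv ℝ m x (curl m x)⟫) =
      (∫ x, cutoff ((n : ℝ) + 1) x * ⟪convect (fun _ => a) (curl m) x, curl m x⟫) +
        (∫ x, cutoff ((n : ℝ) + 1) x * ⟪convect (⇑W) (curl m) x, curl m x⟫) +
        c' * (2 * (∫ x, cutoff ((n : ℝ) + 1) x * ‖curl m x‖ ^ 2) +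
          ∫ x, cutoff ((n : ℝ) + 1) x * ⟪fderiv ℝ (curl m) x x, curl m x⟫) := by
    intro n
    have hR : (0 : ℝ) < (n : ℝ) + 1 := by positivity
    have iL : Integrable (fun x => cutoff ((n : ℝ) + 1) x * ⟪Δ (curl m) x, curl m x⟫) :=
      integrable_cutoff_mul (hΔwc.inner hwc) hR
    have iC : Integrable (fun x => cutoff ((n : ℝ) + 1) x * ⟪convect m (curl m) x, curl m x⟫) :=
      integrable_cutoff_mul ((hDwc.clm_apply hmc).inner hwc) hR
    have iS : Integrable (fun x => cutoff ((n : ℝ) + 1) x * ⟪curl m x, fderiv ℝ m x (curl m x)⟫) :=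
      integrable_cutoff_mul (hwc.inner (hDmc.clm_apply hwc)) hR
    have iA : Integrable
        (fun x => cutoff ((n : ℝ) + 1) x * ⟪convect (fun _ => a) (curl m) x, curl m x⟫) :=
      integrable_cutoff_mul ((hDwc.clm_apply continuous_const).inner hwc) hR
    have iR : Integrable (fun x => cutoff ((n : ℝ) + 1) x * ⟪convect (⇑W) (curl m) x, curl m x⟫) :=
      integrable_cutoff_mul ((hDwc.clm_apply W.continuous).inner hwc) hR
    have iZ : Integrable (fun x => cutoff ((n : ℝ) + 1) x * ‖curl m x‖ ^ 2) :=
      integrable_cutoff_mul (hwc.norm.pow 2) hR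
    have iD : Integrable (fun x => cutoff ((n : ℝ) + 1) x * ⟪fderiv ℝ (curl m) x x, curl m x⟫) :=
      integrable_cutoff_mul ((hDwc.clm_apply continuous_id).inner hwc) hR
    have lhs : ν * (∫ x, cutoff ((n : ℝ) + 1) x * ⟪Δ (curl m) x, curl m x⟫) -
        (∫ x, cutoff ((n : ℝ) + 1) x * ⟪convect m (curl m) x, curl m x⟫) +
        (∫ x, cutoff ((n : ℝ) + 1) x * ⟪curl m x, fderiv ℝ m x (curl m x)⟫) =
        ∫ x, (ν * (cutoff ((n : ℝ) + 1) x * ⟪Δ (curl m) x, curl m x⟫) -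
          cutoff ((n : ℝ) + 1) x * ⟪convect m (curl m) x, curl m x⟫ +
          cutoff ((n : ℝ) + 1) x * ⟪curl m x, fderiv ℝ m x (curl m x)⟫) := by
      have iLν : Integrable (fun x => ν * (cutoff ((n : ℝ) + 1) x * ⟪Δ (curl m) x, curl m x⟫)) :=
        iL.const_mul ν
      have iLC : Integrable (fun x => ν * (cutoff ((n : ℝ) + 1) x * ⟪Δ (curl m) x, curl m x⟫) -
          cutoff ((n : ℝ) + 1) x * ⟪convect m (curl m) x, curl m x⟫) := iLν.sub iC
      rw [integral_add iLC iS, integral_sub iLν iC, integral_const_mul]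
    have rhs : (∫ x, cutoff ((n : ℝ) + 1) x * ⟪convect (fun _ => a) (curl m) x, curl m x⟫) +
        (∫ x, cutoff ((n : ℝ) + 1) x * ⟪convect (⇑W) (curl m) x, curl m x⟫) +
        c' * (2 * (∫ x, cutoff ((n : ℝ) + 1) x * ‖curl m x‖ ^ 2) +
          ∫ x, cutoff ((n : ℝ) + 1) x * ⟪fderiv ℝ (curl m) x x, curl m x⟫) =
        ∫ x, (cutoff ((n : ℝ) + 1) x * ⟪convect (fun _ => a) (curl m) x, curl m x⟫ +
          cutoff ((n : ℝ) + 1) x * ⟪convect (⇑W) (curl m) x, curl m x⟫ +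
          c' * (2 * (cutoff ((n : ℝ) + 1) x * ‖curl m x‖ ^ 2) +
            cutoff ((n : ℝ) + 1) x * ⟪fderiv ℝ (curl m) x x, curl m x⟫)) := by
      have iAR : Integrable (fun x => cutoff ((n : ℝ) + 1) x * ⟪convect (fun _ => a) (curl m) x, curl m x⟫ +
          cutoff ((n : ℝ) + 1) x * ⟪convect (⇑W) (curl m) x, curl m x⟫) := iA.add iR
      have iZ2 : Integrable (fun x => 2 * (cutoff ((n : ℝ) + 1) x * ‖curl m x‖ ^ 2)) := iZ.const_mul 2
      have iZD : Integrable (fun x => 2 * (cutoff ((n : ℝ) + 1) x * ‖curl m x‖ ^ 2) +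
          cutoff ((n : ℝ) + 1) x * ⟪fderiv ℝ (curl m) x x, curl m x⟫) := iZ2.add iD
      have iZDc : Integrable (fun x => c' * (2 * (cutoff ((n : ℝ) + 1) x * ‖curl m x‖ ^ 2) +
          cutoff ((n : ℝ) + 1) x * ⟪fderiv ℝ (curl m) x x, curl m x⟫)) := iZD.const_mul c'
      rw [integral_add iAR iZDc, integral_add iA iR, integral_const_mul, integral_add iZ2 iD,
        integral_const_mul]
    rw [lhs, rhs]
    refine integral_congr_ae (ae_of_all _ fun x => ?_)
    dsimp only
    have e : ν * (cutoff ((n : ℝ) + 1) x * ⟪Δ (curl m) x, curl m x⟫) -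
        cutoff ((n : ℝ) + 1) x * ⟪convect m (curl m) x, curl m x⟫ +
        cutoff ((n : ℝ) + 1) x * ⟪curl m x, fderiv ℝ m x (curl m x)⟫ =
        cutoff ((n : ℝ) + 1) x * (ν * ⟪Δ (curl m) x, curl m x⟫ - ⟪convect m (curl m) x, curl m x⟫ +
          ⟪curl m x, fderiv ℝ m x (curl m x)⟫) := by ring
    rw [e, hpt x]
    ring
  -- the cut-off integrations by parts, substituted
  have hfg : ∀ n : ℕ,
      2 * ν * (-(∫ x, cutoff ((n : ℝ) + 1) x * frobeniusNormSq (fderiv ℝ (curl m) x)) +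
          1 / 2 * ∫ x, ‖curl m x‖ ^ 2 * (Δ (cutoff (E := (EuclideanSpace ℝ (Fin 3))) ((n : ℝ) + 1))) x) +
        (∫ x, fderiv ℝ (cutoff ((n : ℝ) + 1)) x (m x) * ‖curl m x‖ ^ 2) +
        2 * (∫ x, cutoff ((n : ℝ) + 1) x * ⟪curl m x, fderiv ℝ m x (curl m x)⟫) =
      -(∫ x, fderiv ℝ (cutoff ((n : ℝ) + 1)) x ((fun _ : (EuclideanSpace ℝ (Fin 3)) => a) x) * ‖curl m x‖ ^ 2) +
        -(∫ x, fderiv ℝ (cutoff ((n : ℝ) + 1)) x (W x) * ‖curl m x‖ ^ 2) +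
        c' * (4 * (∫ x, cutoff ((n : ℝ) + 1) x * ‖curl m x‖ ^ 2) +
          (-(∫ x, fderiv ℝ (cutoff ((n : ℝ) + 1)) x x * ‖curl m x‖ ^ 2) -
            3 * ∫ x, cutoff ((n : ℝ) + 1) x * ‖curl m x‖ ^ 2)) := by
    intro n
    have hR : (0 : ℝ) < (n : ℝ) + 1 := by positivity
    have h := hn n
    have e1 := integral_mul_inner_laplacian_self_eq (contDiff_cutoff ((n : ℝ) + 1))
      (hasCompactSupport_cutoff (E := (EuclideanSpace ℝ (Fin 3))) hR) hw
    have e2 := two_mul_integral_mul_inner_convect_self_eq_of_isDivFree (contDiff_cutoff ((n : ℝ) + 1))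
      (hasCompactSupport_cutoff (E := (EuclideanSpace ℝ (Fin 3))) hR) hw hm hdiv
    have e3 := two_mul_integral_mul_inner_convect_self_eq_of_isDivFree (contDiff_cutoff ((n : ℝ) + 1))
      (hasCompactSupport_cutoff (E := (EuclideanSpace ℝ (Fin 3))) hR) hw contDiff_const (isDivFree_const a)
    have e4 := two_mul_integral_mul_inner_convect_self_eq_of_isDivFree (contDiff_cutoff ((n : ℝ) + 1))
      (hasCompactSupport_cutoff (E := (EuclideanSpace ℝ (Fin 3))) hR) hw W.contDiff (isDivFree_skew hW)
    have e6 := two_mul_integral_mul_inner_fderiv_self_self_eq (contDiff_cutoff ((n : ℝ) + 1))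
      (hasCompactSupport_cutoff (E := (EuclideanSpace ℝ (Fin 3))) hR) hw
    have hdim : (Module.finrank ℝ (EuclideanSpace ℝ (Fin 3)) : ℝ) = 3 := by simp
    rw [hdim] at e6
    linear_combination 2 * h - 2 * ν * e1 + e2 + e3 + e4 + c' * e6
  -- the limits `n → ∞`
  have tP := tendsto_integral_cutoff_mul IF
  have tE := tendsto_integral_norm_sq_mul_laplacian_cutoff I2
  have tM := tendsto_integral_fderiv_cutoff_apply_mul_of_integrable IM
  have tS := tendsto_integral_cutoff_mul IS
  have tA := tendsto_integral_fderiv_cutoff_apply_mul I2 (V := fun _ : (EuclideanSpace ℝ (Fin 3)) => a) (M := ‖a‖)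
    (fun x => le_rfl)
  have tR := tendsto_integral_fderiv_cutoff_apply_mul_of_linearGrowth hwc I2 W.continuous (M := ‖W‖)
    (fun x => W.le_opNorm x)
  have tZ := tendsto_integral_cutoff_mul I2
  have tD := tendsto_integral_fderiv_cutoff_self_mul hwc I2
  have tF := (((tP.neg.add (tE.const_mul (1 / 2 : ℝ))).const_mul (2 * ν)).add tM).add (tS.const_mul 2)
  have tG := (tA.neg.add tR.neg).add
    (((tZ.const_mul 4).add (tD.neg.sub (tZ.const_mul 3))).const_mul c')
  have key := tendsto_nhds_unique (tF.congr hfg) tG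
  linear_combination (1 / 2 : ℝ) * key

/-- **(EB) in the vocabulary of the item** (the hypothesis `hEB` of
`MaximiserSetRigidity.partB_of_enstrophyBalance_of_collapseLiouville`, p820369, verbatim): every admissible `m`
(smooth, divergence free, `D⁰m, D¹m, D²m ∈ L²`) solving the relative-equilibrium profile equation
`νΔm − (m·∇)m − ∇π = (a·∇)m + ((Wx)·∇)m − Wm + c′(m + (x·∇)m)` with `π` smooth and `W` skew-adjoint satisfies
`S(m) − ν·Pal(m) = (c′/2)·Z(m)`. [folklore] -/
theorem enstrophyBalance (ν : ℝ) :
    ∀ (m : EuclideanSpace ℝ (Fin 3) → EuclideanSpace ℝ (Fin 3)) (π : EuclideanSpace ℝ (Fin 3) → ℝ) (a :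
      EuclideanSpace ℝ (Fin 3)) (W : EuclideanSpace ℝ (Fin 3) →L[ℝ] EuclideanSpace ℝ (Fin 3)) (c' : ℝ),
      (ContDiff ℝ (⊤ : ℕ∞) m ∧ Literature.Analysis.FluidPDE.VectorCalculus.IsDivFree m ∧ (∫⁻ x,
      ‖iteratedFDeriv ℝ 0 m x‖ₑ ^ 2 < ⊤) ∧ (∫⁻ x, ‖iteratedFDeriv ℝ 1 m x‖ₑ ^ 2 < ⊤) ∧ (∫⁻ x, ‖iteratedFDeriv
      ℝ 2 m x‖ₑ ^ 2 < ⊤)) → ContDiff ℝ (⊤ : ℕ∞) π → (∀ x y : EuclideanSpace ℝ (Fin 3), ⟪W x, y⟫_ℝ = -⟪x, W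
      y⟫_ℝ) → (∀ x : EuclideanSpace ℝ (Fin 3), ν • Laplacian.laplacian m x -
      Literature.Analysis.FluidPDE.convect m m x - gradient π x = fderiv ℝ m x a + (fderiv ℝ m x (W x) - W (m
      x)) + c' • (m x + fderiv ℝ m x x)) → (∫ x, ⟪Literature.Analysis.FluidPDE.curl m x, fderiv ℝ m x
      (Literature.Analysis.FluidPDE.curl m x)⟫_ℝ) - ν * (∫ x, Literature.Analysis.FluidPDE.frobeniusNormSq
      (fderiv ℝ (Literature.Analysis.FluidPDE.curl m) x)) = c' / 2 * (∫ x, ‖Literature.Analysis.FluidPDE.curl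
      m x‖ ^ 2) := by
  intro m π a W c' hadm hπ hW heq
  obtain ⟨hm, hdiv, h0, h1, h2⟩ := hadm
  exact stretch_sub_visc_eq hm hdiv h0 h1 h2 (contDiff_infty.1 hπ 2) hW heq

/-- **Part (b) of `MaximiserSetRigidity` for every normalised maximiser, from the collapse Liouville theorem alone.**
With (EB) now PROVED (`enstrophyBalance`), the typed reduction p820369
(`partB_of_enstrophyBalance_of_collapseLiouville`) leaves exactly ONE analytic input: (L⁺) no admissible `m` with
`Z(m) > 0` solves the profile equation with a COLLAPSING rate `c′ > 0` (backward self-similar / rotating /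
translating Liouville theorem of Nečas–Růžička–Šverák / Tsai / Pineau–Vicol type in the class `D⁰m, D¹m, D²m ∈ L²`).
Given (L⁺), every `m` satisfying the item's normalised-maximiser clause verbatim (for `c, ν > 0`) satisfies the
item's (b)-clause verbatim. HONEST FRAMING: an implication; (L⁺), part (a), stmt-25512, `RigidExit`,
`LerayFloorGap`, `ProductionEfficiencyDecay` and Navier–Stokes regularity stay OPEN. [folklore] -/
theorem partB_of_collapseLiouville (c ν : ℝ) (hc : 0 < c) (hν : 0 < ν)
    (hL : ∀ (m : EuclideanSpace ℝ (Fin 3) → EuclideanSpace ℝ (Fin 3)) (π : EuclideanSpace ℝ (Fin 3) → ℝ) (a :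
      EuclideanSpace ℝ (Fin 3)) (W : EuclideanSpace ℝ (Fin 3) →L[ℝ] EuclideanSpace ℝ (Fin 3)) (c' : ℝ),
      (ContDiff ℝ (⊤ : ℕ∞) m ∧ Literature.Analysis.FluidPDE.VectorCalculus.IsDivFree m ∧ (∫⁻ x,
      ‖iteratedFDeriv ℝ 0 m x‖ₑ ^ 2 < ⊤) ∧ (∫⁻ x, ‖iteratedFDeriv ℝ 1 m x‖ₑ ^ 2 < ⊤) ∧ (∫⁻ x, ‖iteratedFDeriv
      ℝ 2 m x‖ₑ ^ 2 < ⊤)) → 0 < (∫ x, ‖Literature.Analysis.FluidPDE.curl m x‖ ^ 2) → ContDiff ℝ (⊤ : ℕ∞) π →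
      (∀ x y : EuclideanSpace ℝ (Fin 3), ⟪W x, y⟫_ℝ = -⟪x, W y⟫_ℝ) → 0 < c' → ¬ (∀ x : EuclideanSpace ℝ (Fin
      3), ν • Laplacian.laplacian m x - Literature.Analysis.FluidPDE.convect m m x - gradient π x = fderiv ℝ m
      x a + (fderiv ℝ m x (W x) - W (m x)) + c' • (m x + fderiv ℝ m x x)))
    (m : EuclideanSpace ℝ (Fin 3) → EuclideanSpace ℝ (Fin 3))
    (hm : ((ContDiff ℝ (⊤ : ℕ∞) m ∧ Literature.Analysis.FluidPDE.VectorCalculus.IsDivFree m ∧ (∫⁻ x, ‖iteratedFDeriv ℝ 0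
      m x‖ₑ ^ 2 < ⊤) ∧ (∫⁻ x, ‖iteratedFDeriv ℝ 1 m x‖ₑ ^ 2 < ⊤) ∧ (∫⁻ x, ‖iteratedFDeriv ℝ 2 m x‖ₑ ^ 2 < ⊤))
      ∧ 0 < (∫ x, ‖Literature.Analysis.FluidPDE.curl m x‖ ^ 2) ∧ (∫ x, ⟪Literature.Analysis.FluidPDE.curl m x,
      fderiv ℝ m x (Literature.Analysis.FluidPDE.curl m x)⟫_ℝ) = c * (∫ x, ‖Literature.Analysis.FluidPDE.curl
      m x‖ ^ 2) ^ (3 / 4 : ℝ) * (∫ x, Literature.Analysis.FluidPDE.frobeniusNormSq (fderiv ℝ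
      (Literature.Analysis.FluidPDE.curl m) x)) ^ (3 / 4 : ℝ) ∧ (∫ x,
      Literature.Analysis.FluidPDE.frobeniusNormSq (fderiv ℝ (Literature.Analysis.FluidPDE.curl m) x)) = 81 *
      c ^ 4 / (256 * ν ^ 4) * (∫ x, ‖Literature.Analysis.FluidPDE.curl m x‖ ^ 2) ^ 3)) :
    ∀ (π : EuclideanSpace ℝ (Fin 3) → ℝ) (a : EuclideanSpace ℝ (Fin 3)) (W : EuclideanSpace ℝ (Fin 3) →L[ℝ]
    EuclideanSpace ℝ (Fin 3)) (c' : ℝ), ContDiff ℝ (⊤ : ℕ∞) π → (∀ x y : EuclideanSpace ℝ (Fin 3), ⟪W x, y⟫_ℝ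
    = -⟪x, W y⟫_ℝ) → ¬ (∀ x : EuclideanSpace ℝ (Fin 3), ν • Laplacian.laplacian m x -
    Literature.Analysis.FluidPDE.convect m m x - gradient π x = fderiv ℝ m x a + (fderiv ℝ m x (W x) - W (m
    x)) + c' • (m x + fderiv ℝ m x x)) :=
  partB_of_enstrophyBalance_of_collapseLiouville c ν hc hν (enstrophyBalance ν) hL m hm

/-- **The self-similar rate of a would-be maximiser profile is forced**: if a normalised maximiser `m` (for
`c, ν > 0`) solves the profile equation with data `(π, a, W, c′)`, then `c′ = (27c⁴/(128ν³))·Z(m)² > 0` — by (EB)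
and the algebra of the normalisation (`rate_pos_of_balance`, p820369). So steady, travelling, rigidly rotating
and expanding maximiser profiles (`c′ ≤ 0`) are excluded UNCONDITIONALLY; only the collapsing case remains, and
it is (L⁺). [folklore] -/
theorem rate_pos_of_profile (c ν : ℝ) (hc : 0 < c) (hν : 0 < ν)
    (m : EuclideanSpace ℝ (Fin 3) → EuclideanSpace ℝ (Fin 3))
    (hm : ((ContDiff ℝ (⊤ : ℕ∞) m ∧ Literature.Analysis.FluidPDE.VectorCalculus.IsDivFree m ∧ (∫⁻ x, ‖iteratedFDeriv ℝ 0
      m x‖ₑ ^ 2 < ⊤) ∧ (∫⁻ x, ‖iteratedFDeriv ℝ 1 m x‖ₑ ^ 2 < ⊤) ∧ (∫⁻ x, ‖iteratedFDeriv ℝ 2 m x‖ₑ ^ 2 < ⊤))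
      ∧ 0 < (∫ x, ‖Literature.Analysis.FluidPDE.curl m x‖ ^ 2) ∧ (∫ x, ⟪Literature.Analysis.FluidPDE.curl m x,
      fderiv ℝ m x (Literature.Analysis.FluidPDE.curl m x)⟫_ℝ) = c * (∫ x, ‖Literature.Analysis.FluidPDE.curl
      m x‖ ^ 2) ^ (3 / 4 : ℝ) * (∫ x, Literature.Analysis.FluidPDE.frobeniusNormSq (fderiv ℝ
      (Literature.Analysis.FluidPDE.curl m) x)) ^ (3 / 4 : ℝ) ∧ (∫ x,
      Literature.Analysis.FluidPDE.frobeniusNormSq (fderiv ℝ (Literature.Analysis.FluidPDE.curl m) x)) = 81 *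
      c ^ 4 / (256 * ν ^ 4) * (∫ x, ‖Literature.Analysis.FluidPDE.curl m x‖ ^ 2) ^ 3))
    {π : EuclideanSpace ℝ (Fin 3) → ℝ} {a : EuclideanSpace ℝ (Fin 3)}
    {W : EuclideanSpace ℝ (Fin 3) →L[ℝ] EuclideanSpace ℝ (Fin 3)} {c' : ℝ} (hπ : ContDiff ℝ (⊤ : ℕ∞) π)
    (hW : ∀ x y : EuclideanSpace ℝ (Fin 3), ⟪W x, y⟫_ℝ = -⟪x, W y⟫_ℝ)
    (heq : ∀ x : EuclideanSpace ℝ (Fin 3), ν • Laplacian.laplacian m x -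
      Literature.Analysis.FluidPDE.convect m m x - gradient π x = fderiv ℝ m x a + (fderiv ℝ m x (W x) - W (m
      x)) + c' • (m x + fderiv ℝ m x x)) : 0 < c' := by
  obtain ⟨hadm, hZ, hS, hN⟩ := hm
  have hbal := enstrophyBalance ν m π a W c' hadm hπ hW heq
  have hP : 0 ≤ ∫ x, frobeniusNormSq (fderiv ℝ (curl m) x) :=
    integral_nonneg fun x => frobeniusNormSq_nonneg _
  exact rate_pos_of_balance hc hν hZ hP hS hN hbal

end ProfileEnstrophyBalance

end MaximiserSetRigidity

end Summit.NavierStokesRegularity.NavierStokesRegularity.Theorems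

end
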